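import Mathlib
import Summits.MatrixMultiplication.MatrixMultiplication.Theses.FidelityWitnesses
import Summits.MatrixMultiplication.MatrixMultiplication.Theorems.FidelityWitnessesFidelityGapTwoSixConeClosure
import Summits.MatrixMultiplication.MatrixMultiplication.Theorems.FidelityGapThreeSeventeen.Negative.BorderRankReduction
import Literature.Computability.AlgebraicComplexity.AsymptoticRankZariskiClosedProofs
import Literature.Computability.AlgebraicComplexity.BorderRankLimit
import Literature.Computability.AlgebraicComplexity.AlderStrassenProofs
import Literature.Computability.AlgebraicComplexity.SchoenhageTauBini
import Literature.Computability.AlgebraicComplexity.FlatteningBound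
import Literature.Computability.AlgebraicComplexity.BigCwFourthOmega
import Literature.Computability.AlgebraicComplexity.CoppersmithWinograd1982Crude

/-!
# `FidelityWitnesses.FidelityThesis` (stmt-MatrixMultiplication-4956) — Negative lane, I:
# the crux is exactly `ω(ℂ) > 2`; what a disproof must be; which exponents / constants are dead

Negative / support lemmas of the standing disprover (`Cruxes/FidelityThesis/Disproof.lean`, §1–§3),
landed for import by ideators, planners and the line lead.  No Theses statement is asserted
positively here.  (Part II, `SuperquadraticRungs`, and part III, `AsymptoticRankConjecture`, are
separate files of this directory.)

* `fidelityThesis_gap_iff_lt_algBorderRank` — for every `n ≥ 1` and `r`, a fidelity gap at `(n, r)`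
  (`∃ ε > 0 …`) holds iff `r < R̲(⟨n,n,n⟩)` (cone criterion `stub_coneClosure` + Alder's theorem, tree
  theorems; generalises the `n = 3` file `FidelityGapThreeSeventeen/Negative/BorderRankReduction`).
* `fidelityThesis_le_omega_of_curve` — a gap all along a curve `r ≤ c·n^{2+δ}` forces `2 + δ ≤ ω(ℂ)`;
  `two_lt_omega_of_fidelityThesis` — the crux implies `ω(ℂ) > 2` (the route's `closes`, restated).
* `omega_le_two_of_not_fidelityThesis` — **any disproof of the crux is a proof of `ω(ℂ) ≤ 2`, i.e. of
  the summit** (Bini's theorem `Blaser2013_thm66_holds` + the reduction): there is no cheap counterexample.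
  `fidelityThesis_false_of_omega_le_two` — conversely `ω(ℂ) ≤ 2` kills it.
* `fidelityThesis_curve_false_of_omega_lt`, `fidelityThesis_curve_false_of_gt` — the EXPONENT is
  load-bearing: no curve with `2 + δ > ω(ℂ)` carries gaps, so by the tree's `ω ≤ 2.37295`
  (`LeGall2014_cw4_omega_le`) every `δ > 0.37295` is dead, for every `c > 0`.
* `fidelityThesis_curve_false_of_one_le` — the CONSTANT is load-bearing: `c ≥ 1` is dead for every `δ`
  (`(n, r) = (1, 1)`, `S = ⟨1,1,1⟩`).
* `fidelityThesis_false_without_rankBound` — the rank hypothesis is load-bearing.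
* `fidelityThesis_curve_zero` — at `δ = 0` (`c = 1/2`) the curve statement is a THEOREM (flattening
  `n² ≤ R̲(⟨n,n,n⟩)`): the hypothesis `0 < δ` carries all the content of the crux.
-/

namespace Summit.MatrixMultiplication.MatrixMultiplication.Theorems

open scoped BigOperators ComplexConjugate
open Filter
open Literature.Computability.AlgebraicComplexity
open Summit.MatrixMultiplication.MatrixMultiplication.Theses.FidelityWitnesses (FidelityThesis)

/-! ## Sums for `⟨n,n,n⟩` -/

-- `Σ_{abc} ⟨n,n,n⟩_{abc} = n³` is the tree lemma `fidelityGapThree_sum_matMulTensor` (general `n`,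
-- `FidelityGapThreeSeventeen/Negative/BorderRankReduction.lean`), reused here.

/-- `Σ ⟨n,n,n⟩·⟨n,n,n⟩ = n³` in `ℂ` (entries are `0/1`). [folklore] -/
theorem fidelityThesis_overlap_self (n : ℕ) :
    (∑ a : Fin n × Fin n, ∑ b : Fin n × Fin n, ∑ c : Fin n × Fin n,
      matMulTensor ℂ n n n a b c * matMulTensor ℂ n n n a b c) = (n : ℂ) ^ 3 := by
  have h : ∀ a b c : Fin n × Fin n, matMulTensor ℂ n n n a b c * matMulTensor ℂ n n n a b c
      = matMulTensor ℂ n n n a b c := by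
    intro a b c
    simp only [matMulTensor]
    split_ifs <;> simp
  simp_rw [h]
  exact fidelityGapThree_sum_matMulTensor ℂ n

/-- `‖⟨n,n,n⟩‖² = n³`. [folklore] -/
theorem fidelityThesis_normSq_matMulTensor (n : ℕ) :
    (∑ a : Fin n × Fin n, ∑ b : Fin n × Fin n, ∑ c : Fin n × Fin n,
      ‖matMulTensor ℂ n n n a b c‖ ^ 2) = (n : ℝ) ^ 3 := by
  have h : ∀ a b c : Fin n × Fin n, ‖matMulTensor ℂ n n n a b c‖ ^ 2 = matMulTensor ℝ n n n a b c := by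
    intro a b c
    simp only [matMulTensor]
    split_ifs <;> simp
  simp_rw [h]
  exact fidelityGapThree_sum_matMulTensor ℝ n

/-- Sesquilinear and bilinear overlaps with the real tensor `⟨n,n,n⟩` have the same norm.
[folklore] -/
theorem fidelityThesis_norm_overlap_conj {n : ℕ}
    (S : Fin n × Fin n → Fin n × Fin n → Fin n × Fin n → ℂ) :
    ‖∑ a, ∑ b, ∑ c, (starRingEnd ℂ) (S a b c) * matMulTensor ℂ n n n a b c‖ =
      ‖∑ a, ∑ b, ∑ c, S a b c * matMulTensor ℂ n n n a b c‖ := by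
  have hconj : ∀ a b c : Fin n × Fin n,
      (starRingEnd ℂ) (matMulTensor ℂ n n n a b c) = matMulTensor ℂ n n n a b c := by
    intro a b c
    unfold matMulTensor
    split_ifs <;> simp
  have h : (∑ a, ∑ b, ∑ c, (starRingEnd ℂ) (S a b c) * matMulTensor ℂ n n n a b c)
      = (starRingEnd ℂ) (∑ a, ∑ b, ∑ c, S a b c * matMulTensor ℂ n n n a b c) := by
    simp only [map_sum, map_mul, hconj]
  rw [h, Complex.norm_conj]

/-- `⟨n,n,n⟩` itself violates every gap inequality with `ε > 0` (`n ≥ 1`): `n⁶ ≤ (1 − ε)·n⁶` is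
absurd. [folklore] -/
theorem fidelityThesis_not_gap_self {n : ℕ} (hn : 1 ≤ n) {ε : ℝ} (hε : 0 < ε) :
    ¬ ‖∑ a, ∑ b, ∑ c, matMulTensor ℂ n n n a b c * matMulTensor ℂ n n n a b c‖ ^ 2 ≤
      (1 - ε) * (n : ℝ) ^ 3 * ∑ a, ∑ b, ∑ c, ‖matMulTensor ℂ n n n a b c‖ ^ 2 := by
  rw [fidelityThesis_overlap_self, fidelityThesis_normSq_matMulTensor, norm_pow, Complex.norm_natCast]
  have hpos : (0 : ℝ) < (n : ℝ) ^ 3 * (n : ℝ) ^ 3 := by positivity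
  intro h
  nlinarith

/-! ## The rung reduction: a gap at `(n, r)` is exactly `r < R̲(⟨n,n,n⟩)` -/

/-- **No gap at `(n, r)` if `⟨n,n,n⟩` is a limit of rank-`≤ r` tensors** (`n ≥ 1`; continuity: the
strict fidelity inequality at `S = ⟨n,n,n⟩` is an open condition). [folklore] -/
theorem fidelityThesis_gap_false_of_mem_closure {n r : ℕ} (hn : 1 ≤ n)
    (h : matMulTensor ℂ n n n ∈ closure {S : Fin n × Fin n → Fin n × Fin n → Fin n × Fin n → ℂ |
      tensorRank S ≤ r}) :
    ¬ ∃ ε : ℝ, 0 < ε ∧ ∀ S : Fin n × Fin n → Fin n × Fin n → Fin n × Fin n → ℂ,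
      tensorRank S ≤ r →
        ‖∑ a, ∑ b, ∑ c, S a b c * matMulTensor ℂ n n n a b c‖ ^ 2 ≤
          (1 - ε) * (n : ℝ) ^ 3 * ∑ a, ∑ b, ∑ c, ‖S a b c‖ ^ 2 := by
  rintro ⟨ε, hε, hgap⟩
  set f : (Fin n × Fin n → Fin n × Fin n → Fin n × Fin n → ℂ) → ℝ := fun S =>
    ‖∑ a, ∑ b, ∑ c, S a b c * matMulTensor ℂ n n n a b c‖ ^ 2 -
      (1 - ε) * (n : ℝ) ^ 3 * ∑ a, ∑ b, ∑ c, ‖S a b c‖ ^ 2 with hf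
  have hcont : Continuous f := by
    simp only [hf]
    fun_prop
  have hopen : IsOpen (f ⁻¹' Set.Ioi 0) := hcont.isOpen_preimage _ isOpen_Ioi
  have hT : matMulTensor ℂ n n n ∈ f ⁻¹' Set.Ioi 0 := by
    simp only [Set.mem_preimage, Set.mem_Ioi, hf, fidelityThesis_overlap_self,
      fidelityThesis_normSq_matMulTensor, norm_pow, Complex.norm_natCast]
    have hpos : (0 : ℝ) < (n : ℝ) ^ 3 * (n : ℝ) ^ 3 := by positivity
    nlinarith
  obtain ⟨S, hSU, hSC⟩ := mem_closure_iff.1 h _ hopen hT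
  have h1 := hgap S hSC
  simp only [Set.mem_preimage, Set.mem_Ioi, hf] at hSU
  linarith

/-- **A gap at `(n, r)` if `⟨n,n,n⟩` is NOT a limit of rank-`≤ r` tensors** (all `n`; the cone
closure criterion `stub_coneClosure`). [folklore] -/
theorem fidelityThesis_gap_of_notMem_closure {n r : ℕ}
    (h : matMulTensor ℂ n n n ∉ closure {S : Fin n × Fin n → Fin n × Fin n → Fin n × Fin n → ℂ |
      tensorRank S ≤ r}) :
    ∃ ε : ℝ, 0 < ε ∧ ∀ S : Fin n × Fin n → Fin n × Fin n → Fin n × Fin n → ℂ,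
      tensorRank S ≤ r →
        ‖∑ a, ∑ b, ∑ c, S a b c * matMulTensor ℂ n n n a b c‖ ^ 2 ≤
          (1 - ε) * (n : ℝ) ^ 3 * ∑ a, ∑ b, ∑ c, ‖S a b c‖ ^ 2 := by
  by_contra hgap
  refine h (stub_coneClosure _ (fun c S hS => ?_) _ fun ε hε => ?_)
  · show tensorRank (c • S) ≤ r
    exact (tensorRank_smul_le c S).trans hS
  · push Not at hgap
    obtain ⟨S, hS, hlt⟩ := hgap ε hε
    refine ⟨S, hS, ?_⟩
    rw [fidelityThesis_norm_overlap_conj, fidelityThesis_normSq_matMulTensor]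
    have hcomm : (1 - ε) * (∑ a, ∑ b, ∑ c, ‖S a b c‖ ^ 2) * (n : ℝ) ^ 3
        = (1 - ε) * (n : ℝ) ^ 3 * ∑ a, ∑ b, ∑ c, ‖S a b c‖ ^ 2 := by ring
    rw [hcomm]
    exact hlt

/-- **Rung reduction** (`n ≥ 1`): a fidelity gap at `(n, r)` holds iff `r < R̲(⟨n,n,n⟩)` (Alder's
theorem `alder_secantVariety_eq_setOf_algBorderRank_le_holds`, tree theorem). [folklore] -/
theorem fidelityThesis_gap_iff_lt_algBorderRank {n : ℕ} (hn : 1 ≤ n) (r : ℕ) :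
    (∃ ε : ℝ, 0 < ε ∧ ∀ S : Fin n × Fin n → Fin n × Fin n → Fin n × Fin n → ℂ,
      tensorRank S ≤ r →
        ‖∑ a, ∑ b, ∑ c, S a b c * matMulTensor ℂ n n n a b c‖ ^ 2 ≤
          (1 - ε) * (n : ℝ) ^ 3 * ∑ a, ∑ b, ∑ c, ‖S a b c‖ ^ 2) ↔
      r < algBorderRank (matMulTensor ℂ n n n) := by
  rw [← not_le,
    ← mem_closure_setOf_tensorRank_le_iff alder_secantVariety_eq_setOf_algBorderRank_le_holds]
  exact ⟨fun h hmem => fidelityThesis_gap_false_of_mem_closure hn hmem h,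
    fidelityThesis_gap_of_notMem_closure⟩

/-- Honest rank kills a rung: `R(⟨n,n,n⟩) ≤ r → ` no gap at `(n, r)` (`S = ⟨n,n,n⟩`). [folklore] -/
theorem fidelityThesis_gap_false_of_tensorRank_le {n r : ℕ} (hn : 1 ≤ n)
    (h : tensorRank (matMulTensor ℂ n n n) ≤ r) :
    ¬ ∃ ε : ℝ, 0 < ε ∧ ∀ S : Fin n × Fin n → Fin n × Fin n → Fin n × Fin n → ℂ,
      tensorRank S ≤ r →
        ‖∑ a, ∑ b, ∑ c, S a b c * matMulTensor ℂ n n n a b c‖ ^ 2 ≤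
          (1 - ε) * (n : ℝ) ^ 3 * ∑ a, ∑ b, ∑ c, ‖S a b c‖ ^ 2 := by
  rintro ⟨ε, hε, hgap⟩
  exact fidelityThesis_not_gap_self hn hε (hgap _ h)

/-! ## The crux is exactly `ω(ℂ) > 2` -/

/-- **A gap all along the curve `r ≤ c·n^{2+δ}` forces `2 + δ ≤ ω(ℂ)`**: at `r = R(⟨n,n,n⟩)` the gap
fails (`S = ⟨n,n,n⟩`), so `c·n^{2+δ} < R(⟨n,n,n⟩)` for all `n ≥ 1`, and every admissible exponent is
`≥ 2 + δ`. [folklore] -/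
theorem fidelityThesis_le_omega_of_curve {δ c : ℝ} (hc : 0 < c)
    (h : ∀ n r : ℕ, 1 ≤ n → (r : ℝ) ≤ c * (n : ℝ) ^ (2 + δ) →
      ∃ ε : ℝ, 0 < ε ∧ ∀ S : Fin n × Fin n → Fin n × Fin n → Fin n × Fin n → ℂ,
        tensorRank S ≤ r →
          ‖∑ a, ∑ b, ∑ c, S a b c * matMulTensor ℂ n n n a b c‖ ^ 2 ≤
            (1 - ε) * (n : ℝ) ^ 3 * ∑ a, ∑ b, ∑ c, ‖S a b c‖ ^ 2) :
    2 + δ ≤ omega ℂ := by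
  have hrank : ∀ n : ℕ, 1 ≤ n →
      c * (n : ℝ) ^ (2 + δ) ≤ (tensorRank (matMulTensor ℂ n n n) : ℝ) := by
    intro n hn
    by_contra hlt
    rw [not_le] at hlt
    exact fidelityThesis_gap_false_of_tensorRank_le hn le_rfl (h n _ hn hlt.le)
  refine le_csInf (admissibleExponents_nonempty ℂ) ?_
  intro β hβ
  by_contra hlt
  rw [not_le] at hlt
  obtain ⟨C, hC⟩ := hβ.bound
  have hev : ∀ᶠ n : ℕ in atTop, (n : ℝ) ^ (2 + δ - β) ≤ C / c := by
    filter_upwards [hC, eventually_ge_atTop 1] with n hn hn1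
    have hpos : (0 : ℝ) < n := by exact_mod_cast hn1
    rw [Real.norm_of_nonneg (Nat.cast_nonneg _),
      Real.norm_of_nonneg (Real.rpow_nonneg hpos.le _)] at hn
    have hsq : c * (n : ℝ) ^ (2 + δ) ≤ C * (n : ℝ) ^ β := (hrank n hn1).trans hn
    rw [Real.rpow_sub hpos, div_le_iff₀ (Real.rpow_pos_of_pos hpos _), div_mul_eq_mul_div,
      le_div_iff₀ hc]
    linarith
  have ht : Tendsto (fun n : ℕ => (n : ℝ) ^ (2 + δ - β)) atTop atTop :=
    (tendsto_rpow_atTop (by linarith)).comp tendsto_natCast_atTop_atTop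
  obtain ⟨n, hn1, hn2⟩ := (hev.and (ht.eventually_gt_atTop (C / c))).exists
  exact absurd hn1 (not_le.mpr hn2)

/-- **The crux implies `ω(ℂ) > 2`** (indeed `ω(ℂ) ≥ 2 + δ` for its exponent). [folklore] -/
theorem two_lt_omega_of_fidelityThesis (h : FidelityThesis) : 2 < omega ℂ := by
  obtain ⟨δ, hδ, c, hc, hgap⟩ := h
  have := fidelityThesis_le_omega_of_curve hc hgap
  linarith

/-- **`ω(ℂ) ≤ 2` refutes the crux** (contrapositive). [folklore] -/
theorem fidelityThesis_false_of_omega_le_two (h : omega ℂ ≤ 2) : ¬ FidelityThesis :=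
  fun hX => absurd (two_lt_omega_of_fidelityThesis hX) (not_lt.2 h)

/-- **ANY DISPROOF OF THE CRUX IS A PROOF OF `ω(ℂ) ≤ 2`** (i.e. of the summit, given `2 ≤ ω`): if
`ω(ℂ) > 2`, put `δ := (ω − 2)/2`, `c := 1/2`; for `n ≥ 1` and `1 ≤ r ≤ n^{2+δ}/2` (which forces
`n ≥ 2`) a bound `R̲(⟨n,n,n⟩) ≤ r` would give `ω ≤ log_n r < 2 + δ < ω` by Bini's theorem
(`Blaser2013_thm66_holds`), so `r < R̲(⟨n,n,n⟩)` and the rung reduction yields the gap; `r = 0` is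
free (`S = 0`).  Hence `¬ crux → ω(ℂ) ≤ 2`.  There is no cheap counterexample. [folklore] -/
theorem omega_le_two_of_not_fidelityThesis (hX : ¬ FidelityThesis) : omega ℂ ≤ 2 := by
  by_contra hω
  rw [not_le] at hω
  refine hX ⟨(omega ℂ - 2) / 2, by linarith, 1 / 2, by norm_num, fun n r hn hr => ?_⟩
  rcases Nat.eq_zero_or_pos r with rfl | hr1
  · -- `r = 0`: only `S = 0` has rank `0`
    refine ⟨1 / 2, by norm_num, fun S hS => ?_⟩
    have h0 : S = 0 := by
      obtain ⟨w, u, v, hS'⟩ := exists_triad_decomposition_tensorRank S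
      haveI : IsEmpty (Fin (tensorRank S)) := (Nat.le_zero.1 hS) ▸ Fin.isEmpty'
      calc S = ∑ i, triad (w i) (u i) (v i) := hS'
        _ = 0 := Fintype.sum_empty _
    subst h0
    simp
  have hnpow : (0 : ℝ) < (n : ℝ) ^ (2 + (omega ℂ - 2) / 2) :=
    Real.rpow_pos_of_pos (by exact_mod_cast hn) _
  have hn2 : 2 ≤ n := by
    by_contra hlt
    have hn1 : n = 1 := by omega
    subst hn1
    have : (1 : ℝ) ≤ r := by exact_mod_cast hr1
    rw [Nat.cast_one, Real.one_rpow] at hr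
    linarith
  rw [fidelityThesis_gap_iff_lt_algBorderRank hn]
  by_contra hle
  rw [not_lt] at hle
  have hbini := Blaser2013_thm66_holds.cubic ℂ hn2 hr1 hle
  have hrlt : (r : ℝ) < (n : ℝ) ^ (2 + (omega ℂ - 2) / 2) := by linarith
  have hlog : Real.logb n r < 2 + (omega ℂ - 2) / 2 :=
    (Real.logb_lt_iff_lt_rpow (by exact_mod_cast hn2) (by exact_mod_cast hr1)).2 hrlt
  linarith

/-- So `¬ crux` pins the exponent: `¬ FidelityThesis → ω(ℂ) = 2` (with the flattening bound
`2 ≤ ω(ℂ)`, `omega_two_le`). [folklore] -/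
theorem omega_eq_two_of_not_fidelityThesis (hX : ¬ FidelityThesis) : omega ℂ = 2 :=
  le_antisymm (omega_le_two_of_not_fidelityThesis hX) (omega_two_le ℂ)

/-! ## Load-bearing analysis: exponent, constant, rank bound, `0 < δ` -/

/-- **The exponent is load-bearing**: no curve with `2 + δ > ω(ℂ)` carries gaps, whatever `c > 0`.
[folklore] -/
theorem fidelityThesis_curve_false_of_omega_lt {δ c : ℝ} (hc : 0 < c) (hω : omega ℂ < 2 + δ) :
    ¬ ∀ n r : ℕ, 1 ≤ n → (r : ℝ) ≤ c * (n : ℝ) ^ (2 + δ) →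
      ∃ ε : ℝ, 0 < ε ∧ ∀ S : Fin n × Fin n → Fin n × Fin n → Fin n × Fin n → ℂ,
        tensorRank S ≤ r →
          ‖∑ a, ∑ b, ∑ c, S a b c * matMulTensor ℂ n n n a b c‖ ^ 2 ≤
            (1 - ε) * (n : ℝ) ^ 3 * ∑ a, ∑ b, ∑ c, ‖S a b c‖ ^ 2 :=
  fun h => absurd (fidelityThesis_le_omega_of_curve hc h) (not_le.2 hω)

/-- **Refuted strengthening — every exponent `δ > 0.37295` is dead** (tree theorem `ω ≤ 2.37295`,
Le Gall 2014 / the fourth power of the Coppersmith–Winograd tensor, `LeGall2014_cw4_omega_le`): any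
proof of the crux must place its gaps below `r ≈ n^{2.373}`. [folklore] -/
theorem fidelityThesis_curve_false_of_gt {δ c : ℝ} (hc : 0 < c) (hδ : 0.37295 < δ) :
    ¬ ∀ n r : ℕ, 1 ≤ n → (r : ℝ) ≤ c * (n : ℝ) ^ (2 + δ) →
      ∃ ε : ℝ, 0 < ε ∧ ∀ S : Fin n × Fin n → Fin n × Fin n → Fin n × Fin n → ℂ,
        tensorRank S ≤ r →
          ‖∑ a, ∑ b, ∑ c, S a b c * matMulTensor ℂ n n n a b c‖ ^ 2 ≤
            (1 - ε) * (n : ℝ) ^ 3 * ∑ a, ∑ b, ∑ c, ‖S a b c‖ ^ 2 :=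
  fidelityThesis_curve_false_of_omega_lt hc (by have := LeGall2014_cw4_omega_le ℂ; linarith)

/-- **The constant is load-bearing — `c ≥ 1` is dead for every `δ`**: `(n, r) = (1, 1)` is then on
the curve and `S = ⟨1,1,1⟩` (rank `≤ 1`) has fidelity `1`. [folklore] -/
theorem fidelityThesis_curve_false_of_one_le {δ c : ℝ} (hc : 1 ≤ c) :
    ¬ ∀ n r : ℕ, 1 ≤ n → (r : ℝ) ≤ c * (n : ℝ) ^ (2 + δ) →
      ∃ ε : ℝ, 0 < ε ∧ ∀ S : Fin n × Fin n → Fin n × Fin n → Fin n × Fin n → ℂ,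
        tensorRank S ≤ r →
          ‖∑ a, ∑ b, ∑ c, S a b c * matMulTensor ℂ n n n a b c‖ ^ 2 ≤
            (1 - ε) * (n : ℝ) ^ 3 * ∑ a, ∑ b, ∑ c, ‖S a b c‖ ^ 2 := by
  intro h
  have h11 := h 1 1 le_rfl (by simp only [Nat.cast_one, Real.one_rpow]; linarith)
  exact fidelityThesis_gap_false_of_tensorRank_le le_rfl
    (by simpa using tensorRank_matMulTensor_le ℂ 1 1 1) h11

/-- **The rank hypothesis is load-bearing**: with `tensorRank S ≤ r` dropped the statement is false
(`(n, r) = (1, 0)`, `S = ⟨1,1,1⟩`). [folklore] -/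
theorem fidelityThesis_false_without_rankBound :
    ¬ ∃ δ : ℝ, 0 < δ ∧ ∃ c : ℝ, 0 < c ∧ ∀ n r : ℕ, 1 ≤ n → (r : ℝ) ≤ c * (n : ℝ) ^ (2 + δ) →
      ∃ ε : ℝ, 0 < ε ∧ ∀ S : Fin n × Fin n → Fin n × Fin n → Fin n × Fin n → ℂ,
        ‖∑ a, ∑ b, ∑ c, S a b c * matMulTensor ℂ n n n a b c‖ ^ 2 ≤
          (1 - ε) * (n : ℝ) ^ 3 * ∑ a, ∑ b, ∑ c, ‖S a b c‖ ^ 2 := by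
  rintro ⟨δ, hδ, c, hc, h⟩
  obtain ⟨ε, hε, hS⟩ := h 1 0 le_rfl (by simp only [Nat.cast_zero, Nat.cast_one, Real.one_rpow]; linarith)
  exact fidelityThesis_not_gap_self le_rfl hε (hS (matMulTensor ℂ 1 1 1))

/-- **`0 < δ` carries all the content**: at `δ = 0`, `c = 1/2` the curve statement is a THEOREM —
`r ≤ n²/2 < n² ≤ R̲(⟨n,n,n⟩)` (flattening, `mul_le_algBorderRank_matMulTensor`) and the rung
reduction. [folklore] -/
theorem fidelityThesis_curve_zero :
    ∀ n r : ℕ, 1 ≤ n → (r : ℝ) ≤ (1 / 2) * (n : ℝ) ^ (2 + (0 : ℝ)) →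
      ∃ ε : ℝ, 0 < ε ∧ ∀ S : Fin n × Fin n → Fin n × Fin n → Fin n × Fin n → ℂ,
        tensorRank S ≤ r →
          ‖∑ a, ∑ b, ∑ c, S a b c * matMulTensor ℂ n n n a b c‖ ^ 2 ≤
            (1 - ε) * (n : ℝ) ^ 3 * ∑ a, ∑ b, ∑ c, ‖S a b c‖ ^ 2 := by
  intro n r hn hr
  rw [fidelityThesis_gap_iff_lt_algBorderRank hn]
  haveI : NeZero n := ⟨by omega⟩
  have hflat : n * n ≤ algBorderRank (matMulTensor ℂ n n n) :=
    mul_le_algBorderRank_matMulTensor ℂ n n n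
  have hn1 : (1 : ℝ) ≤ n := by exact_mod_cast hn
  have hr' : (r : ℝ) < (n * n : ℕ) := by
    rw [add_zero, show ((2 : ℝ)) = ((2 : ℕ) : ℝ) by norm_num, Real.rpow_natCast] at hr
    push_cast
    nlinarith
  exact_mod_cast hr'.trans_le (by exact_mod_cast hflat : ((n * n : ℕ) : ℝ) ≤ algBorderRank _)

end Summit.MatrixMultiplication.MatrixMultiplication.Theorems
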